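import Mathlib
import HarnessLib
import Summits.Ventures.LatticeQCDFlow.Exactness.CircleUniformAngle

/-!
# The engine's Box–Muller Gaussian generator is exact: two uniforms give `N(0,1) ⊗ N(0,1)`

HONEST FRAMING: exact (Metropolis-corrected) sampling algorithms for lattice gauge theory;
figures of merit are autocorrelation/cost numbers at stated couplings and volumes; no
continuum-physics claim.

Venture `LatticeQCDFlow` (cell pub-lqcd), topic `Exactness`, FANOUT row 9 (eng-latcore, the
engine `latflow.core`).  NEW WORK of the cell over Mathlib (`gaussianReal`,
`lintegral_image_eq_lintegral_abs_deriv_mul`, `AddCircle.lintegral_preimage`) and row 9's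
`CircleUniformAngle.lean` (`lintegral_gaussian2_polar`: the planar Gaussian in polar coordinates) and
`UniformAngleCauchy.lean` (`unitLaw`, `−log U ∼ Exp(1)`).  Nothing is cited as a fact.  Printed
counterpart, NAMED ONLY: Box–Muller, Ann. Math. Statist. 29 (1958) 610.

The Gaussian primitive of the 4-d kernel (`csrc/latcore_template.c` `rng_gauss`, feeding the HMC
momenta `lc_momenta`) is Box–Muller: from two uniforms `u₁ ∈ (0,1)`, `u₂`, return
`√(−2 log u₁) cos(2π u₂)`.  In idealised real arithmetic:

* **`lintegral_sqrt_neg_two_log_unitLaw`** — the radius `√(−2 log u₁)` has the Rayleigh law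
  `r e^{−r²/2} dr` on `(0, ∞)` (`−log u₁ ∼ Exp(1)`, then `x = r²/2`);
* **`lintegral_two_pi_mul_unitLaw`** — for a `2π`-periodic integrand the angle `2π u₂` may be
  integrated over `(−π, π)` with weight `(2π)⁻¹`;
* `boxMuller`, **`map_boxMuller`** — THE PAIR IS EXACT:
  `(unitLaw ⊗ unitLaw).map (u ↦ (√(−2 log u₁) cos 2πu₂, √(−2 log u₁) sin 2πu₂)) = N(0,1) ⊗ N(0,1)`;
* **`map_boxMuller_cos`** — THE ENGINE'S SINGLE VARIATE IS EXACT: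
  `(unitLaw ⊗ unitLaw).map (u ↦ √(−2 log u₁) cos 2πu₂) = gaussianReal 0 1`.

NOT CLAIMED: floating point (53-bit uniforms, libm `log`/`cos`/`sqrt`); the Marsaglia polar variant
of the 2-d kernels (`cpn_kernel.c`, `phi4_kernel.c`; separate file `MarsagliaPolar.lean`); the
`i H` Hermitian assembly of `lc_momenta` (a linear map of independent Gaussians; LAW side).
-/

namespace Summit.Ventures.LatticeQCDFlow.Exactness

open MeasureTheory Measure Set Real ProbabilityTheory
open scoped ENNReal

/-! ## §1 The radius `√(−2 log u)` is Rayleigh -/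

/-- `r ↦ r²/2` maps `(0, ∞)` onto `(0, ∞)`. -/
theorem image_sq_half_Ioi : (fun r : ℝ => r ^ 2 / 2) '' Ioi 0 = Ioi 0 := by
  ext x
  constructor
  · rintro ⟨r, hr, rfl⟩
    have hr' : (0 : ℝ) < r := hr
    simp only [mem_Ioi]
    positivity
  · intro hx
    refine ⟨Real.sqrt (2 * x), Real.sqrt_pos.2 (by linarith [mem_Ioi.1 hx]), ?_⟩
    simp only [Real.sq_sqrt (by linarith [mem_Ioi.1 hx] : (0 : ℝ) ≤ 2 * x)]
    ring

/-- **The Box–Muller radius is Rayleigh**: for every `g ≥ 0`,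
`∫ g(√(−2 log u)) d unitLaw(u) = ∫_{(0,∞)} r e^{−r²/2} g(r) dr`. -/
theorem lintegral_sqrt_neg_two_log_unitLaw (g : ℝ → ℝ≥0∞) :
    ∫⁻ u, g (Real.sqrt (-2 * Real.log u)) ∂unitLaw =
      ∫⁻ r in Ioi 0, ENNReal.ofReal (r * Real.exp (-r ^ 2 / 2)) * g r := by
  have h1 : (fun u : ℝ => g (Real.sqrt (-2 * Real.log u))) = fun u => (fun x => g (Real.sqrt (2 * x))) (-Real.log u) := by
    funext u; simp only [mul_neg, neg_mul]
  rw [h1, lintegral_neg_log_unitLaw (fun x => g (Real.sqrt (2 * x)))]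
  -- substitute `x = r²/2`
  have hderiv : ∀ r ∈ Ioi (0 : ℝ), HasDerivWithinAt (fun r : ℝ => r ^ 2 / 2) r (Ioi 0) r := by
    intro r _
    have h := ((hasDerivAt_pow 2 r).div_const 2).hasDerivWithinAt (s := Ioi 0)
    refine h.congr_deriv ?_
    push_cast; ring
  have hinj : InjOn (fun r : ℝ => r ^ 2 / 2) (Ioi 0) := by
    intro r hr s hs h
    have hr' : (0 : ℝ) < r := hr
    have hs' : (0 : ℝ) < s := hs
    have h2 : r ^ 2 = s ^ 2 := by simp only at h; linarith
    exact (pow_left_inj₀ hr'.le hs'.le two_ne_zero).1 h2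
  have hsub := lintegral_image_eq_lintegral_abs_deriv_mul measurableSet_Ioi hderiv hinj
    (fun x => ENNReal.ofReal (Real.exp (-x)) * g (Real.sqrt (2 * x)))
  rw [image_sq_half_Ioi] at hsub
  rw [hsub]
  refine setLIntegral_congr_fun measurableSet_Ioi fun r hr => ?_
  have hr' : (0 : ℝ) < r := hr
  rw [abs_of_pos hr', show 2 * (r ^ 2 / 2) = r ^ 2 by ring, Real.sqrt_sq hr'.le, ← mul_assoc,
    ← ENNReal.ofReal_mul hr'.le, show -(r ^ 2 / 2) = -r ^ 2 / 2 by ring]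

/-! ## §2 The angle `2πu` over one period -/

/-- **The Box–Muller angle**: for a measurable `2π`-periodic `h ≥ 0`,
`∫ h(2πu) d unitLaw(u) = (2π)⁻¹ ∫_{(−π,π)} h(θ) dθ`. -/
theorem lintegral_two_pi_mul_unitLaw {h : ℝ → ℝ≥0∞} (hper : Function.Periodic h (2 * π)) :
    ∫⁻ u, h (2 * π * u) ∂unitLaw = ∫⁻ θ in Ioo (-π) π, ENNReal.ofReal (1 / (2 * π)) * h θ := by
  have hπ : 0 < 2 * π := by positivity
  rw [lintegral_unitLaw]
  have himg : (fun u : ℝ => 2 * π * u) '' Ioo 0 1 = Ioo 0 (2 * π) := by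
    ext θ
    constructor
    · rintro ⟨u, hu, rfl⟩; exact ⟨by nlinarith [hu.1, pi_pos], by nlinarith [hu.2, pi_pos]⟩
    · intro hθ
      exact ⟨θ / (2 * π), ⟨div_pos hθ.1 hπ, (div_lt_one hπ).mpr hθ.2⟩, mul_div_cancel₀ _ hπ.ne'⟩
  have hderiv : ∀ u ∈ Ioo (0 : ℝ) 1, HasDerivWithinAt (fun u : ℝ => 2 * π * u) (2 * π) (Ioo 0 1) u := by
    intro u _
    simpa using ((hasDerivAt_id u).const_mul (2 * π)).hasDerivWithinAt
  have hinj : InjOn (fun u : ℝ => 2 * π * u) (Ioo 0 1) := (mul_right_injective₀ hπ.ne').injOn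
  have hsub := lintegral_image_eq_lintegral_abs_deriv_mul measurableSet_Ioo hderiv hinj
    (fun θ => ENNReal.ofReal (1 / (2 * π)) * h θ)
  rw [himg] at hsub
  have hpt : ∀ u : ℝ, ENNReal.ofReal |2 * π| * (ENNReal.ofReal (1 / (2 * π)) * h (2 * π * u)) = h (2 * π * u) := by
    intro u
    rw [← mul_assoc, ← ENNReal.ofReal_mul (abs_nonneg _), abs_of_pos hπ, mul_one_div_cancel hπ.ne',
      ENNReal.ofReal_one, one_mul]
  simp_rw [hpt] at hsub
  rw [← hsub, setLIntegral_congr Ioo_ae_eq_Ioc, setLIntegral_congr (Ioo_ae_eq_Ioc (a := -π) (b := π))]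
  have hper' : Function.Periodic (fun θ => ENNReal.ofReal (1 / (2 * π)) * h θ) (2 * π) :=
    fun θ => by simp only [hper θ]
  have hw := lintegral_Ioc_periodic hper' 0 (-π)
  rw [zero_add, show -π + 2 * π = π by ring] at hw
  exact hw

/-! ## §3 Box–Muller -/

/-- **The Box–Muller map**: `(u₁, u₂) ↦ (√(−2 log u₁) cos 2πu₂, √(−2 log u₁) sin 2πu₂)`. -/
noncomputable def boxMuller (p : ℝ × ℝ) : ℝ × ℝ :=
  (Real.sqrt (-2 * Real.log p.1) * Real.cos (2 * π * p.2), Real.sqrt (-2 * Real.log p.1) * Real.sin (2 * π * p.2))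

/-- `boxMuller` is measurable. -/
theorem measurable_boxMuller : Measurable boxMuller := by
  unfold boxMuller
  refine Measurable.prodMk ?_ ?_ <;>
    exact ((Real.continuous_sqrt.measurable.comp (measurable_const.mul (Real.measurable_log.comp measurable_fst))).mul
      (by fun_prop))

/-- **BOX–MULLER IS EXACT**: two independent uniforms give two independent standard Gaussians. -/
theorem map_boxMuller : (unitLaw.prod unitLaw).map boxMuller = (gaussianReal 0 1).prod (gaussianReal 0 1) := by
  refine Measure.ext_of_lintegral _ fun F hF => ?_
  rw [lintegral_map hF measurable_boxMuller,
    lintegral_prod (fun p : ℝ × ℝ => F (boxMuller p)) (hF.comp measurable_boxMuller).aemeasurable,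
    lintegral_gaussian2_polar hF]
  -- the angle, for each `u₁`
  have hθ : ∀ u₁ : ℝ, ∫⁻ u₂, F (boxMuller (u₁, u₂)) ∂unitLaw =
      ∫⁻ θ in Ioo (-π) π, ENNReal.ofReal (1 / (2 * π)) *
        F (Real.sqrt (-2 * Real.log u₁) * Real.cos θ, Real.sqrt (-2 * Real.log u₁) * Real.sin θ) := by
    intro u₁
    have hper : Function.Periodic (fun θ => F (Real.sqrt (-2 * Real.log u₁) * Real.cos θ,
        Real.sqrt (-2 * Real.log u₁) * Real.sin θ)) (2 * π) := fun θ => by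
      simp only [Real.cos_periodic θ, Real.sin_periodic θ]
    exact lintegral_two_pi_mul_unitLaw hper
  simp_rw [hθ]
  -- the radius
  rw [lintegral_sqrt_neg_two_log_unitLaw (fun r => ∫⁻ θ in Ioo (-π) π, ENNReal.ofReal (1 / (2 * π)) *
    F (r * Real.cos θ, r * Real.sin θ))]
  refine setLIntegral_congr_fun measurableSet_Ioi fun r hr => ?_
  have hr' : (0 : ℝ) < r := hr
  have hm : Measurable fun θ : ℝ => ENNReal.ofReal (1 / (2 * π)) * F (r * Real.cos θ, r * Real.sin θ) :=
    measurable_const.mul (hF.comp (by fun_prop))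
  rw [← lintegral_const_mul _ hm]
  refine lintegral_congr fun θ => ?_
  rw [← mul_assoc, ← ENNReal.ofReal_mul (by positivity)]
  congr 2
  field_simp

/-- **THE ENGINE'S GAUSSIAN GENERATOR IS EXACT** (`latcore_template.c` `rng_gauss`):
`√(−2 log u₁) cos(2π u₂)` of two independent uniforms is standard normal. -/
theorem map_boxMuller_cos :
    (unitLaw.prod unitLaw).map (fun p : ℝ × ℝ => Real.sqrt (-2 * Real.log p.1) * Real.cos (2 * π * p.2)) =
      gaussianReal 0 1 := by
  rw [show (fun p : ℝ × ℝ => Real.sqrt (-2 * Real.log p.1) * Real.cos (2 * π * p.2)) = Prod.fst ∘ boxMuller from rfl,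
    ← Measure.map_map measurable_fst measurable_boxMuller, map_boxMuller, Measure.map_fst_prod, measure_univ,
    one_smul]

end Summit.Ventures.LatticeQCDFlow.Exactness
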